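import Mathlib
import Summits.PneNP.PneNP.Theorems.OverlapGapAlgebraSolvableImpliesStableSectionDensityLiftAssembly

/-!
# PneNP / OverlapGapAlgebra — crux `SolvableImpliesStableSection` (stmt-PneNP-2463):
# the DENSITY LIFT block (appendix) — the new core lies strictly inside the previous one

Support for crux `stmt-PneNP-2463` (`Summit.PneNP.PneNP.Theses.OverlapGapAlgebra.SolvableImpliesStableSection`).
Numbers behind the claim that the density-lift edge `2^{-k}(1 - α_UC(k)/α)` (`sissDL_conclusion`)
supersedes both earlier all-density `ν`-edges of the crux's core: with `λ = kα2^{-k}` and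
`λ_UC(k) = kα_UC(k)2^{-k} = k/((k²-k)·2M_k) = ½((k-1)/(k-2))^{k-2} ≥ 1` (`sissDL_threshold_le`, Bernoulli),
`e^{λ} ≥ 1 + λ` gives `2^{-k}(1 - α_UC(k)/α) < 2^{-k}(1 - e^{-λ}/2)` (the filtered-repair edge of
`sissF_conclusion`) at EVERY density (`sissDL_edge_lt_filteredEdge`), and `< 2^{-k}(e^{λ} - 1)` (the
two-way-repair edge) on the core `α ≥ α_UC(k)` (`sissDL_edge_lt_repairEdge`); hence the core of
`sissDL_solvableImpliesStableSection_iff_core` is contained in the core of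
`sissF_solvableImpliesStableSection_iff_core` (`sissDL_core_subset`).

* `sissDL_threshold_le` — `(k²-k)·2M_k ≤ k`, i.e. `λ_UC(k) ≥ 1`;
* `sissDL_edge_lt_filteredEdge`, `sissDL_edge_lt_repairEdge` — the two comparisons;
* `sissDL_core_subset` — the new core implies the old core constraints (registered).
No definitions; axioms `propext`, `Classical.choice`, `Quot.sound`.
-/

set_option linter.dupNamespace false -- `Summit.PneNP.PneNP.…`: summit = sub-problem (D-0017)

namespace Summit.PneNP.PneNP.Theorems

open Finset Filter
open scoped Classical

section DensityLiftCompare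

/-- **`λ_UC(k) ≥ 1`.** For `k ≥ 3`: `(k²-k)·2M_k ≤ k` (`M_k = (k-2)^{k-2}/(k-1)^{k-1}`), i.e.
`2(k-2)^{k-2} ≤ (k-1)^{k-2}` — Bernoulli's inequality `(1 + 1/(k-2))^{k-2} ≥ 2`. -/
theorem sissDL_threshold_le (k : ℕ) (hk : 3 ≤ k) :
    ((k * k - k : ℕ) : ℝ) * (2 * (((k : ℝ) - 2) ^ (k - 2) / ((k : ℝ) - 1) ^ (k - 1))) ≤ k := by
  obtain ⟨j, rfl⟩ : ∃ j, k = j + 2 := ⟨k - 2, by omega⟩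
  have hj1 : 1 ≤ j := by omega
  have hx1 : (1 : ℝ) ≤ (j : ℝ) := by exact_mod_cast hj1
  have hx0 : (0 : ℝ) < (j : ℝ) := by linarith
  -- Bernoulli: `2 j^j ≤ (j+1)^j`
  have hkey : 2 * (j : ℝ) ^ j ≤ ((j : ℝ) + 1) ^ j := by
    have hneg : (-2 : ℝ) ≤ 1 / (j : ℝ) := by
      have : 0 < 1 / (j : ℝ) := by positivity
      linarith
    have h1 := one_add_mul_le_pow hneg j
    have h2 : (j : ℝ) * (1 / (j : ℝ)) = 1 := by field_simp
    rw [h2] at h1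
    have h3 : ((1 : ℝ) + 1 / j) ^ j * (j : ℝ) ^ j = ((j : ℝ) + 1) ^ j := by
      rw [← mul_pow]; congr 1; field_simp
    have h4 : (2 : ℝ) * (j : ℝ) ^ j ≤ ((1 : ℝ) + 1 / j) ^ j * (j : ℝ) ^ j :=
      mul_le_mul_of_nonneg_right (by linarith) (by positivity)
    linarith [h3 ▸ h4]
  -- the casts and exponents
  have hsub : (j + 2) * (j + 2) - (j + 2) = (j + 2) * (j + 1) := by
    rw [show (j + 2) * (j + 2) = (j + 2) * (j + 1) + (j + 2) by ring, Nat.add_sub_cancel]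
  rw [hsub, show j + 2 - 2 = j from by omega, show j + 2 - 1 = j + 1 from by omega]
  push_cast
  have e1 : ((j : ℝ) + 2 - 2) = j := by ring
  have e2 : ((j : ℝ) + 2 - 1) = j + 1 := by ring
  rw [e1, e2, pow_succ]
  have hj10 : (0 : ℝ) < (j : ℝ) + 1 := by linarith
  have hle1 : 2 * (j : ℝ) ^ j / ((j : ℝ) + 1) ^ j ≤ 1 := (div_le_one (by positivity)).2 hkey
  calc ((j : ℝ) + 2) * ((j : ℝ) + 1) * (2 * ((j : ℝ) ^ j / (((j : ℝ) + 1) ^ j * ((j : ℝ) + 1))))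
      = ((j : ℝ) + 2) * (2 * (j : ℝ) ^ j / ((j : ℝ) + 1) ^ j) := by
        field_simp
    _ ≤ ((j : ℝ) + 2) * 1 := mul_le_mul_of_nonneg_left hle1 (by positivity)
    _ = (j : ℝ) + 2 := mul_one _

/-- `kα_UC(k)2^{-k} ≥ 1`: the threshold density in the natural scale `λ = kα2^{-k}`. -/
theorem sissDL_one_le_lambdaUC (k : ℕ) (hk : 3 ≤ k) :
    1 ≤ k * ((2 : ℝ) ^ k / (((k * k - k : ℕ) : ℝ) *
      (2 * (((k : ℝ) - 2) ^ (k - 2) / ((k : ℝ) - 1) ^ (k - 1))))) * (1 / 2 : ℝ) ^ k := by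
  have hk3 : (3 : ℝ) ≤ k := by exact_mod_cast hk
  have hMk0 : (0 : ℝ) < ((k : ℝ) - 2) ^ (k - 2) / ((k : ℝ) - 1) ^ (k - 1) := by
    have h1 : (0 : ℝ) < (k : ℝ) - 1 := by linarith
    have h2 : (0 : ℝ) < (k : ℝ) - 2 := by linarith
    positivity
  have hkk : (0 : ℝ) < ((k * k - k : ℕ) : ℝ) := by
    have h : 1 ≤ k * k - k := by
      have : k + 1 ≤ k * k := by nlinarith
      omega
    exact_mod_cast h
  have hK0 : (0 : ℝ) < ((k * k - k : ℕ) : ℝ) * (2 * (((k : ℝ) - 2) ^ (k - 2) / ((k : ℝ) - 1) ^ (k - 1))) := by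
    positivity
  have hle := sissDL_threshold_le k hk
  have hhalf : (2 : ℝ) ^ k * (1 / 2 : ℝ) ^ k = 1 := by
    rw [← mul_pow]; norm_num
  calc (1 : ℝ) ≤ k / (((k * k - k : ℕ) : ℝ) * (2 * (((k : ℝ) - 2) ^ (k - 2) / ((k : ℝ) - 1) ^ (k - 1)))) := by
        rw [le_div_iff₀ hK0, one_mul]; exact hle
    _ = k * ((2 : ℝ) ^ k / (((k * k - k : ℕ) : ℝ) *
          (2 * (((k : ℝ) - 2) ^ (k - 2) / ((k : ℝ) - 1) ^ (k - 1))))) * (1 / 2 : ℝ) ^ k := by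
        rw [show (k : ℝ) * ((2 : ℝ) ^ k / (((k * k - k : ℕ) : ℝ) *
            (2 * (((k : ℝ) - 2) ^ (k - 2) / ((k : ℝ) - 1) ^ (k - 1))))) * (1 / 2 : ℝ) ^ k =
            k / (((k * k - k : ℕ) : ℝ) * (2 * (((k : ℝ) - 2) ^ (k - 2) / ((k : ℝ) - 1) ^ (k - 1)))) *
              ((2 : ℝ) ^ k * (1 / 2 : ℝ) ^ k) from by ring, hhalf, mul_one]

/-- **The density-lift edge is below the filtered-repair edge at every density.** For `k ≥ 3` and every
`α > 0`: `2^{-k}(1 - α_UC(k)/α) < 2^{-k}(1 - e^{-kα2^{-k}}/2)`. -/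
theorem sissDL_edge_lt_filteredEdge (k : ℕ) (hk : 3 ≤ k) (α : ℝ) (hα : 0 < α) :
    (1 / 2 : ℝ) ^ k * (1 - (2 : ℝ) ^ k / (((k * k - k : ℕ) : ℝ) *
      (2 * (((k : ℝ) - 2) ^ (k - 2) / ((k : ℝ) - 1) ^ (k - 1)))) / α) <
    (1 / 2 : ℝ) ^ k * (1 - Real.exp (-(k * α * (1 / 2 : ℝ) ^ k)) / 2) := by
  set p : ℝ := (1 / 2 : ℝ) ^ k with hp
  set αUC : ℝ := (2 : ℝ) ^ k / (((k * k - k : ℕ) : ℝ) *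
      (2 * (((k : ℝ) - 2) ^ (k - 2) / ((k : ℝ) - 1) ^ (k - 1)))) with hαUC
  have hp0 : 0 < p := by rw [hp]; positivity
  have hlamUC : 1 ≤ k * αUC * p := sissDL_one_le_lambdaUC k hk
  have hk0 : (0 : ℝ) ≤ k := Nat.cast_nonneg _
  refine mul_lt_mul_of_pos_left ?_ hp0
  -- `e^{-λ}/2 < α_UC/α`, i.e. `α < 2 α_UC e^{λ}`
  have hexp : k * α * p < Real.exp (k * α * p) := by
    have := Real.add_one_le_exp (k * α * p); linarith
  have hαUC0 : 0 < αUC := by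
    have : 0 < k * αUC * p := by linarith
    have hkp : 0 ≤ k * p := by positivity
    by_contra h
    push Not at h
    have : k * αUC * p ≤ 0 := by
      have := mul_nonpos_of_nonneg_of_nonpos hkp h  -- (k p) * αUC ≤ 0
      linarith [this, show k * αUC * p = k * p * αUC from by ring]
    linarith
  have h1 : α < 2 * αUC * Real.exp (k * α * p) := by
    have h2 : α ≤ (k * αUC * p) * α := by nlinarith
    have h3 : (k * αUC * p) * α = αUC * (k * α * p) := by ring
    have h4 : αUC * (k * α * p) < αUC * Real.exp (k * α * p) := mul_lt_mul_of_pos_left hexp hαUC0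
    have h5 : 0 < αUC * Real.exp (k * α * p) := by positivity
    linarith
  -- rearrange
  have hE : 0 < Real.exp (k * α * p) := Real.exp_pos _
  have h6 : Real.exp (-(k * α * p)) / 2 < αUC / α := by
    rw [Real.exp_neg, div_lt_div_iff₀ (by positivity) hα]
    calc (Real.exp (k * α * p))⁻¹ * α = α / Real.exp (k * α * p) := by
          rw [inv_mul_eq_div]
      _ < 2 * αUC * Real.exp (k * α * p) / Real.exp (k * α * p) := div_lt_div_of_pos_right h1 hE
      _ = αUC * 2 := by field_simp
  linarith

/-- **The density-lift edge is below the two-way-repair edge on the core.** For `k ≥ 3` and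
`α ≥ α_UC(k)` (`2^k ≤ α·(k²-k)·2M_k`): `2^{-k}(1 - α_UC(k)/α) < 2^{-k}(e^{kα2^{-k}} - 1)`. -/
theorem sissDL_edge_lt_repairEdge (k : ℕ) (hk : 3 ≤ k) (α : ℝ) (hα : 0 < α)
    (hcore : (2 : ℝ) ^ k ≤ α * ((k * k - k : ℕ) : ℝ) *
      (2 * (((k : ℝ) - 2) ^ (k - 2) / ((k : ℝ) - 1) ^ (k - 1)))) :
    (1 / 2 : ℝ) ^ k * (1 - (2 : ℝ) ^ k / (((k * k - k : ℕ) : ℝ) *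
      (2 * (((k : ℝ) - 2) ^ (k - 2) / ((k : ℝ) - 1) ^ (k - 1)))) / α) <
    (1 / 2 : ℝ) ^ k * (Real.exp (k * α * (1 / 2 : ℝ) ^ k) - 1) := by
  set p : ℝ := (1 / 2 : ℝ) ^ k with hp
  have hp0 : 0 < p := by rw [hp]; positivity
  have hk3 : (3 : ℝ) ≤ k := by exact_mod_cast hk
  have hMk0 : (0 : ℝ) < ((k : ℝ) - 2) ^ (k - 2) / ((k : ℝ) - 1) ^ (k - 1) := by
    have h1 : (0 : ℝ) < (k : ℝ) - 1 := by linarith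
    have h2 : (0 : ℝ) < (k : ℝ) - 2 := by linarith
    positivity
  have hkk : (0 : ℝ) < ((k * k - k : ℕ) : ℝ) := by
    have h : 1 ≤ k * k - k := by
      have : k + 1 ≤ k * k := by nlinarith
      omega
    exact_mod_cast h
  set K : ℝ := ((k * k - k : ℕ) : ℝ) * (2 * (((k : ℝ) - 2) ^ (k - 2) / ((k : ℝ) - 1) ^ (k - 1))) with hK
  have hK0 : 0 < K := by rw [hK]; positivity
  set αUC : ℝ := (2 : ℝ) ^ k / K with hαUC
  have hαUC0 : 0 < αUC := by rw [hαUC]; positivity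
  have hlamUC : 1 ≤ k * αUC * p := sissDL_one_le_lambdaUC k hk
  have hge : αUC ≤ α := by
    rw [hαUC, div_le_iff₀ hK0, hK, ← mul_assoc]; exact hcore
  refine mul_lt_mul_of_pos_left ?_ hp0
  have hk0 : (0 : ℝ) ≤ k := Nat.cast_nonneg _
  have hlam : 1 ≤ k * α * p := by
    have : k * αUC * p ≤ k * α * p := by
      have := mul_le_mul_of_nonneg_left hge hk0
      nlinarith
    linarith
  have hexp : 2 ≤ Real.exp (k * α * p) := by
    have := Real.add_one_le_exp (k * α * p); linarith
  have hfrac : 0 < αUC / α := by positivity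
  linarith

/-- **The new core lies inside the previous core** (registered): for `k ≥ 3`, `α > 0` on the core
`α ≥ α_UC(k)` and every `ν ≤ 2^{-k}(1 - α_UC(k)/α)`, both earlier core constraints
`ν ≤ 2^{-k}(1 - e^{-kα2^{-k}}/2)` and `ν ≤ 2^{-k}(e^{kα2^{-k}} - 1)` hold (strictly) — so
`sissDL_solvableImpliesStableSection_iff_core` restricts the crux to a subregion of the core of
`sissF_solvableImpliesStableSection_iff_core`. -/
theorem sissDL_core_subset (k : ℕ) (hk : 3 ≤ k) (α ν : ℝ) (hα : 0 < α)
    (hcore : (2 : ℝ) ^ k ≤ α * ((k * k - k : ℕ) : ℝ) *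
      (2 * (((k : ℝ) - 2) ^ (k - 2) / ((k : ℝ) - 1) ^ (k - 1))))
    (hν : ν ≤ (1 / 2 : ℝ) ^ k * (1 - (2 : ℝ) ^ k / (((k * k - k : ℕ) : ℝ) *
      (2 * (((k : ℝ) - 2) ^ (k - 2) / ((k : ℝ) - 1) ^ (k - 1)))) / α)) :
    ν < (1 / 2 : ℝ) ^ k * (1 - Real.exp (-(k * α * (1 / 2 : ℝ) ^ k)) / 2) ∧
      ν < (1 / 2 : ℝ) ^ k * (Real.exp (k * α * (1 / 2 : ℝ) ^ k) - 1) :=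
  ⟨hν.trans_lt (sissDL_edge_lt_filteredEdge k hk α hα),
    hν.trans_lt (sissDL_edge_lt_repairEdge k hk α hα hcore)⟩

end DensityLiftCompare

end Summit.PneNP.PneNP.Theorems
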